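import Summits.AtomisticToContinuum.FouriersLaw.Theorems.CageBudgetFeketeUnboundedHeatVarianceAbelForm
import Summits.AtomisticToContinuum.FouriersLaw.Theses.CoercivePulse
import HarnessLib

/-!
# `CageBudgetFekete.UnboundedHeatVariance` is downstream of CoercivePulse's diffusive lower envelope

Support file (`--supports stmt-AtomisticToContinuum-15771`) of the line lead of `birth`. The open stub of the line
is S2′ `stub_abelDivergence` (Abel form of U: `ν⁻¹∫₀^∞e^{-νt}C_T → ∞`, kernel-checked equivalent to U in
`CageBudgetFeketeUnboundedHeatVarianceAbelForm`). This file records, as a kernel-checked DEPENDENCY EDGE between two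
routes sharing the same arena, that S2′ — hence U — follows from the sibling route CoercivePulse's positivity crux
`LinearSpread` (stmt-AtomisticToContinuum-15382: the Helfand moment `M(t) = Σ x² S(x,t)` of the energy pulse has a
diffusive lower envelope `m·t ≤ M(t)`, `t ≥ t₂`) together with its calculus item `PulseCalculus` (Helfand's identity
in Laplace form `A(ν) = (ν²/2)∫₀^∞e^{-νt}(M(t) − M(0))dt`):

* `stub_abelDivergenceOfLinearSpread` — `LinearSpread → PulseCalculus → S2′` (the Abelian step: `M(t) − M(0) ≥ mt − c`
  for all `t > 0` by continuity of `M` on `[0, max t₂ 0]`, so `A(ν) ≥ m/2 − (c/2)ν` and `ν⁻¹A(ν) ≥ m/(2ν) − c/2 → ∞`);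
* `unboundedHeatVariance_of_linearSpread` — `LinearSpread → PulseCalculus → UnboundedHeatVariance`.

So a proof of CoercivePulse's rank-2 crux closes this crux by a one-liner (the converse is false: U has no rate).
No definitions. prover-line-stmt-AtomisticToContinuum-15771-0, 2026-08-17 (cycle 1).
-/

noncomputable section

namespace Summit.AtomisticToContinuum.FouriersLaw.Theorems.UnboundedHeatVariance.Birth

open MeasureTheory Set Filter Topology
open Literature.MathematicalPhysics.KineticTheory.HeatConduction
open Summit.AtomisticToContinuum.FouriersLaw.Theses

/-- The two Laplace integrals `∫₀^∞ e^{-νt}(pt + q) dt = p/ν² + q/ν` (`ν > 0`), with integrability. [folklore] -/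
theorem integral_exp_neg_mul_affine {ν : ℝ} (hν : 0 < ν) (p q : ℝ) :
    IntegrableOn (fun t : ℝ => Real.exp (-(ν * t)) * (p * t + q)) (Ioi 0) ∧
      ∫ t in Ioi (0:ℝ), Real.exp (-(ν * t)) * (p * t + q) = p * (ν ^ 2)⁻¹ + q * ν⁻¹ := by
  have hE0 : IntegrableOn (fun t => Real.exp (-(ν * t))) (Ioi 0) ∧
      ∫ t in Ioi (0:ℝ), Real.exp (-(ν * t)) = ν⁻¹ := by
    refine ⟨by simpa only [neg_mul] using exp_neg_integrableOn_Ioi 0 hν, ?_⟩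
    rw [show (fun t : ℝ => Real.exp (-(ν * t))) = fun t => Real.exp (-ν * t) from
        funext fun t => by rw [neg_mul],
      integral_exp_mul_Ioi (neg_lt_zero.mpr hν) 0, mul_zero, Real.exp_zero, neg_div, one_div, inv_neg, neg_neg]
  have hE1 : IntegrableOn (fun t => Real.exp (-(ν * t)) * t) (Ioi 0) ∧
      ∫ t in Ioi (0:ℝ), Real.exp (-(ν * t)) * t = (ν ^ 2)⁻¹ := by
    have h := Real.integral_rpow_mul_exp_neg_mul_Ioi (a := 2) (r := ν) (by norm_num) hν
    rw [Real.Gamma_two, mul_one, Real.rpow_two, one_div, inv_pow] at h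
    have hv : ∫ t in Ioi (0:ℝ), Real.exp (-(ν * t)) * t = (ν ^ 2)⁻¹ :=
      (setIntegral_congr_fun measurableSet_Ioi fun t _ => by
        rw [show (2:ℝ) - 1 = 1 by norm_num, Real.rpow_one, mul_comm]).trans h
    exact ⟨Integrable.of_integral_ne_zero (by rw [hv]; positivity), hv⟩
  obtain ⟨hi0, hv0⟩ := hE0
  obtain ⟨hi1, hv1⟩ := hE1
  rw [show (fun t : ℝ => Real.exp (-(ν * t)) * (p * t + q)) =
      fun t => p * (Real.exp (-(ν * t)) * t) + q * Real.exp (-(ν * t)) from funext fun t => by ring]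
  exact ⟨(hi1.const_mul p).add (hi0.const_mul q), by
    rw [integral_add (hi1.const_mul p) (hi0.const_mul q), integral_const_mul, integral_const_mul, hv1, hv0]⟩

/-- **Abelian step.** If `F` is continuous, `F(t) ≥ m·t` for `t ≥ t₂`, and for `ν > 0` the function
`e^{-νt}(F(t) − F(0))` is integrable on `(0,∞)` with `A(ν) = (ν²/2)∫₀^∞e^{-νt}(F(t) − F(0))dt`, then
`ν⁻¹A(ν) → +∞` as `ν ↓ 0` whenever `m > 0` (indeed `A(ν) ≥ m/2 − (c/2)ν`). [folklore; Hardy–Littlewood Abelian half] -/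
theorem tendsto_inv_mul_atTop_of_linear_lower_envelope (A F : ℝ → ℝ) (hF : Continuous F) {m t₂ : ℝ}
    (hm : 0 < m) (hlow : ∀ t : ℝ, t₂ ≤ t → m * t ≤ F t)
    (hint : ∀ ν : ℝ, 0 < ν → IntegrableOn (fun t : ℝ => Real.exp (-(ν * t)) * (F t - F 0)) (Ioi 0))
    (hA : ∀ ν : ℝ, 0 < ν → A ν = ν ^ 2 / 2 * ∫ t in Ioi (0:ℝ), Real.exp (-(ν * t)) * (F t - F 0)) :
    Tendsto (fun ν : ℝ => ν⁻¹ * A ν) (𝓝[>] 0) atTop := by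
  -- a uniform affine minorant `m t - c ≤ F t - F 0` on `t > 0`
  set T' : ℝ := max t₂ 0 with hT'
  obtain ⟨B, hB⟩ := isCompact_Icc.exists_bound_of_continuousOn (s := Icc (0:ℝ) T') hF.continuousOn
  have hB0 : |F 0| ≤ B := by
    have h := hB 0 ⟨le_rfl, le_max_right _ _⟩
    rwa [Real.norm_eq_abs] at h
  have hBnn : 0 ≤ B := (abs_nonneg _).trans hB0
  set c : ℝ := m * T' + B + |F 0| with hc
  have hT'0 : 0 ≤ T' := le_max_right _ _
  have hminor : ∀ t : ℝ, 0 < t → m * t - c ≤ F t - F 0 := by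
    intro t ht
    have hF0 : -|F 0| ≤ -F 0 := neg_le_neg (le_abs_self _)
    rcases le_or_gt T' t with hge | hlt
    · have h1 : m * t ≤ F t := hlow t ((le_max_left _ _).trans hge)
      have h2 : 0 ≤ m * T' := mul_nonneg hm.le hT'0
      linarith
    · have h1 : |F t| ≤ B := by
        have h := hB t ⟨ht.le, hlt.le⟩
        rwa [Real.norm_eq_abs] at h
      have h2 : -B ≤ F t := by linarith [neg_abs_le (F t)]
      have h3 : m * t ≤ m * T' := mul_le_mul_of_nonneg_left hlt.le hm.le
      linarith
  -- hence `ν⁻¹ A ν ≥ m/(2ν) - c/2` for `ν > 0`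
  have hAlow : ∀ ν : ℝ, 0 < ν → m / 2 * ν⁻¹ - c / 2 ≤ ν⁻¹ * A ν := by
    intro ν hν
    obtain ⟨iL, vL⟩ := integral_exp_neg_mul_affine hν m (-c)
    have cL := setIntegral_mono_on iL (hint ν hν) measurableSet_Ioi
      fun t ht => mul_le_mul_of_nonneg_left (by linarith [hminor t ht]) (Real.exp_pos (-(ν * t))).le
    rw [vL] at cL
    have hAν : m / 2 - c / 2 * ν ≤ A ν := by
      rw [hA ν hν, ← show ν ^ 2 / 2 * (m * (ν ^ 2)⁻¹ + -c * ν⁻¹) = m / 2 - c / 2 * ν by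
        field_simp; ring]
      exact mul_le_mul_of_nonneg_left cL (by positivity)
    have hνinv : 0 < ν⁻¹ := inv_pos.2 hν
    calc m / 2 * ν⁻¹ - c / 2 = ν⁻¹ * (m / 2 - c / 2 * ν) := by field_simp
      _ ≤ ν⁻¹ * A ν := mul_le_mul_of_nonneg_left hAν hνinv.le
  -- and the minorant tends to `+∞`
  have hg : Tendsto (fun ν : ℝ => m / 2 * ν⁻¹ - c / 2) (𝓝[>] 0) atTop := by
    have h1 : Tendsto (fun ν : ℝ => m / 2 * ν⁻¹) (𝓝[>] 0) atTop :=
      tendsto_inv_nhdsGT_zero.const_mul_atTop (by positivity)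
    simpa only [sub_eq_add_neg] using tendsto_atTop_add_const_right _ (-(c / 2)) h1
  refine tendsto_atTop_mono' _ ?_ hg
  filter_upwards [eventually_mem_nhdsWithin] with ν hν
  exact hAlow ν hν

/-- **`stub_abelDivergenceOfLinearSpread`** — CoercivePulse's diffusive lower envelope of the Helfand moment
(`LinearSpread`, stmt-AtomisticToContinuum-15382) and its pulse calculus (`PulseCalculus`: summability of
`(1+x²)|S(x,t)|`, continuity of `M`, Helfand's identity in Laplace form) imply the open stub S2′ `stub_abelDivergence`
of line `birth` (statement verbatim after the two hypotheses): in the arena, `ν⁻¹∫₀^∞e^{-νt}C_T(t)dt → ∞` as `ν ↓ 0`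
(by `tendsto_inv_mul_atTop_of_linear_lower_envelope`). [folklore; Helfand1960] -/
theorem stub_abelDivergenceOfLinearSpread :
    Summit.AtomisticToContinuum.FouriersLaw.Theses.CoercivePulse.LinearSpread → Summit.AtomisticToContinuum.FouriersLaw.Theses.CoercivePulse.PulseCalculus → ∀ ω₂ lam β γ : ℝ, 0 < ω₂ → 0 < lam → 0 < β → ∀ T : ℝ, 0 < T → ∀ μ : MeasureTheory.Measure Literature.MathematicalPhysics.KineticTheory.HeatConduction.ChainConfig, (Literature.MathematicalPhysics.KineticTheory.HeatConduction.pinnedChain ω₂ lam β γ).IsChainGibbsMeasure T μ → Literature.MathematicalPhysics.KineticTheory.HeatConduction.IsShiftInvariant μ → μ.map (fun σ : Literature.MathematicalPhysics.KineticTheory.HeatConduction.ChainConfig => fun x : ℤ => ((σ x).1, -(σ x).2)) = μ → ∀ D : Literature.MathematicalPhysics.KineticTheory.HeatConduction.InfiniteChainDynamics (Literature.MathematicalPhysics.KineticTheory.HeatConduction.pinnedChain ω₂ lam β γ), D.PreservesMeasure μ → (∀ t : ℝ, ∀ᵐ σ ∂μ, D.flow t (Literature.MathematicalPhysics.KineticTheory.HeatConduction.shift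 σ) = Literature.MathematicalPhysics.KineticTheory.HeatConduction.shift (D.flow t σ)) → (∀ t : ℝ, D.HasAbsConvergentCorrelation μ t) → Continuous (fun t : ℝ => D.currentCorrelation μ t) → Filter.Tendsto (fun ν : ℝ => ν⁻¹ * ∫ t in Set.Ioi (0:ℝ), Real.exp (-(ν * t)) * D.currentCorrelation μ t) (nhdsWithin (0:ℝ) (Set.Ioi 0)) Filter.atTop := by
  intro hLS hPC ω₂ lam β γ hω hl hβ T hT μ hG hSI hRefl D hP hShift _ _
  -- the split-bond site energy, the pulse and its Helfand moment, by the route's formulas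
  set h : ChainConfig → ℤ → ℝ := fun σ x => (σ x).2 ^ 2 / 2 + (pinnedChain ω₂ lam β γ).U (σ x).1 +
    ((pinnedChain ω₂ lam β γ).V ((σ (x + 1)).1 - (σ x).1) +
      (pinnedChain ω₂ lam β γ).V ((σ x).1 - (σ (x - 1)).1)) / 2 with hh
  set S : ℤ → ℝ → ℝ := fun x t => ∫ σ, (h σ 0 - ∫ σ', h σ' 0 ∂μ) * (h (D.flow t σ) x - ∫ σ', h σ' 0 ∂μ) ∂μ
    with hS
  obtain ⟨-, -, hsum, hMc, hLap⟩ := hPC ω₂ lam β γ hω hl hβ T hT μ hG hSI hRefl D hP hShift h hh S hS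
  obtain ⟨m, t₂, hm, hM⟩ := hLS ω₂ lam β γ hω hl hβ T hT μ hG hSI hRefl D hP hShift h hh S hS hsum
  exact tendsto_inv_mul_atTop_of_linear_lower_envelope
    (fun ν => ∫ t in Set.Ioi (0:ℝ), Real.exp (-(ν * t)) * D.currentCorrelation μ t)
    (fun t => ∑' x : ℤ, (x : ℝ) ^ 2 * S x t) hMc hm hM (fun ν hν => (hLap ν hν).1) (fun ν hν => (hLap ν hν).2)

/-- **U is downstream of CoercivePulse's positivity crux.** `LinearSpread → PulseCalculus → UnboundedHeatVariance`
(through the Abel form `unboundedHeatVariance_iff_abel`). [folklore; Helfand1960] -/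
theorem unboundedHeatVariance_of_linearSpread (hLS : CoercivePulse.LinearSpread) (hPC : CoercivePulse.PulseCalculus) :
    CageBudgetFekete.UnboundedHeatVariance :=
  unboundedHeatVariance_iff_abel.2 (stub_abelDivergenceOfLinearSpread hLS hPC)

end Summit.AtomisticToContinuum.FouriersLaw.Theorems.UnboundedHeatVariance.Birth

end
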